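import Literature.NumberTheory.Automorphic.ReciprocityGLnProofs
import Literature.NumberTheory.Automorphic.LocalComponentBJ
import Literature.NumberTheory.Automorphic.LocalLanglandsDatum
import Literature.NumberTheory.Automorphic.AdicCompletionLocalField
import Literature.NumberTheory.GaloisRepresentations.WeilDeligneOfGalois
import Literature.NumberTheory.GaloisRepresentations.WeilDeligneDominance
import HarnessLib

/-!
# Varma 2024, Theorems 1 and 2: local–global compatibility at every `v ∤ p` — equal semisimplifications and dominated monodromy, in Weil–Deligne vocabulary

Topic `Literature/NumberTheory/Automorphic`, next to `ReciprocityGLnProofs` (namespace `Varma2024`: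
`corollary93_unramified`, the unramified-place consequence) and on top of the Weil–Deligne layer:
`WeilDeligneRep`, the Grothendieck–Deligne relation `IsWeilDeligneOfLadic`, the transport
`WeilDeligneRep.IsTransportAlong ι`, the inertial dominance order `WeilDeligneRep.PrecI` (`≺_I`,
`WeilDeligneDominance.lean`), and the local Langlands datum `LocalLanglandsDatum` with
`recTwist L s π_v = rec(π_v ⊗ |det|^s)`.  Requested by route Langlands/EisensteinMonodromy
(support item `GenericWDUnique`: with Theorem 1 and genericity of `WD(r|_{K_v})`, full
Frobenius-semisimple compatibility at `v`).

Source read, verbatim (I. Varma, *Local-global compatibility for regular algebraic cuspidal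
automorphic representations when `ℓ ≠ p`*, Forum Math. Sigma 12 (2024) e21 = arXiv:1411.2520,
Introduction): "Let `F` be an imaginary CM (or totally real) field and let `π` be a regular
algebraic … cuspidal automorphic representation of `GL_n(𝔸_F)`. In [HLTT, Scholze], the authors
construct a continuous semisimple representation (depending on a choice of a rational prime `p`
and an isomorphism `ı : ℚ̄_p ≅ ℂ`) `r_{p,ı}(π) : Gal(F̄/F) → GL_n(ℚ̄_p)` … **Theorem 1 [1^{ss}].**
Keeping the notation of the previous paragraph, let `v ∤ p` be a prime of `F`. Then
`WD(r_{p,ı}(π)|_{G_{F_v}})^{ss} = ı⁻¹ rec_{F_v}(π_v ⊗ |det|_v^{(1-n)/2})^{ss}`. …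
**Theorem 2 [1].** … `WD(r_{p,ı}(π)|_{G_{F_v}})^{Frob-ss} ≺ ı⁻¹ rec_{F_v}(π_v|det|_v^{(1-n)/2})`,
where 'Frob-ss' denotes Frobenius semisimplification." `rec_{F_v}` "as normalized in [HT]".
§8 (arXiv §9), Def. 8.2 (`≺`: for every irreducible `W`-type `ω` up to unramified twist and
every `i ≥ 1`, `m_{1,ω} + ⋯ + m_{i,ω}` for `(σ, N)` is `≤` the same for `(σ', N')`, the `mⱼ` being
the sizes of the `Sp(m)` in `σ[ω]^{F-ss} ≅ ⊕ sᵢ ⊗ Sp(mᵢ)`), Def. 8.3 (`≺_I`: `σ|_{I_v} ≅ σ'|_{I_v}`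
and dominance of the Jordan partitions of `N` on the isotypic components for the irreducible
inertia types), Lemma 8.4 (2) (= Bellaïche–Chenevier 6.5.3): "If `(σ', N')` is another
Weil–Deligne representation of `F_v` such that `σ^{ss} ≅ σ'^{ss}`, then
`(σ, N) ≺ (σ', N') ⇔ (σ, N) ≺_I (σ', N')`."

## Lean rendering (ONE named fact, D-0014)

Quantifier prefix as in `Varma2024.corollary93_unramified` / HLTT Thm. A: `K` totally real or CM,
`π` regular algebraic cuspidal on `GL_n(𝔸_K)` (`CuspidalAutomorphicRepData n K hcpt`, `∀ hcpt`),
`ℓ` (= Varma's `p`), `ι : ℚ̄_ℓ ≃+* ℂ`, and `r_{ℓ,ι}(π)` presented as ANY continuous semisimple `r`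
with HLTT's property (`HarrisLanTaylorThorne2016.IsCompatible π.1 ι r`; all such `r` are
isomorphic by Thm. A's uniqueness, and both conclusions below are isomorphism-invariant).  At a
finite `v ∤ ℓ`: `π_v` is an irreducible smooth `πv` which IS the local component
(`HasLocalComponentAt`, Flath); `W` IS `WD(r|_{Γ_{K_v}})` by the Grothendieck–Deligne recipe
(`IsWeilDeligneOfLadic (r.toLocal v).toWeilGroupHom W`), `Wℂ = ι(W)` (`IsTransportAlong`), and
`S` is any Frobenius-semisimple representative of the class `rec_{K_v}(π_v ⊗ |det|_v^{(1-n)/2})`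
(`recTwist (𝓛 v) ((1-n)/2) πv`) — all conjunctively hypothesised, exactly as in the summit's
`LocalGlobalCompatibleAt`.  Conclusions:
(a) **Theorem 1**: `tr Wℂ.ρ(w) = tr S.ρ(w)` for all `w ∈ W_{K_v}` — over `ℂ`, equality of the
traces of two finite-dimensional representations of a group is equality of their
semisimplifications, and Frobenius-semisimplification does not change traces; this is
`WD(…)^{ss} = ı⁻¹rec(…)^{ss}` read on `ℂ`-points through `ι`.
(b) **Theorem 2**: `Wℂ ≺_I S` (`WeilDeligneRep.PrecI`) — by Lemma 8.4 (2), given (a) the printed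
`≺` of Def. 8.2 coincides with `≺_I` of Def. 8.3, and `≺_I` is insensitive to
Frobenius-semisimplification (`precI_congr_left`), so "`WD(…)^{Frob-ss} ≺`" may be read on `Wℂ`.
**The local Langlands correspondences are bound `∃ 𝓛` once per number field**, outside all
automorphic and Galois variables ("there is a normalisation — Harris–Taylor's `rec_{K_v}` at every
`v` — for which …"), following the uniqueness caveat of `LocalLanglandsDatum` (the datum's axioms
do not pin `rec` outright; a `∀ 𝓛` statement could fail for an exotic normalisation already for
`n = 1`); this is how "`rec_{F_v}` as normalized in [HT]" is rendered.

## Not here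

Varma's Prop. 9.1 / Lemma 9.2 for the `2n`-dimensional `R_{p,ı}(Π)` of an ordinary `p`-adic
automorphic `Π` on `U(n,n)` (no ordinary `p`-adic automorphic forms on unitary similitude groups in
the tree); Def. 8.2 itself (needs the classification of indecomposable Weil–Deligne
representations; not needed by Lemma 8.4 (2)); the places `v ∣ ℓ`. Discharge status: OPEN (XL:
`p`-adic automorphic forms on `U(n,n)`, Bernstein centre, Schneider–Zink types, patching).
-/

noncomputable section

open scoped MatrixGroups Matrix Classical NumberField
open NumberField IsDedekindDomain Field Module

namespace Literature.NumberTheory.Automorphic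

namespace Varma2024

open Literature.NumberTheory.GaloisRepresentations

/-- **Varma 2024, Theorems 1 and 2 (local–global compatibility at every `v ∤ ℓ`: equal
semisimplifications and dominated monodromy).**  Let `K` be totally real or CM.  There is a choice
`𝓛 = (𝓛_v)_v` of local Langlands correspondences of the completions `K_v` (Harris–Taylor's
`rec_{K_v}`) such that: for every `n`, every regular algebraic cuspidal `π` on `GL_n(𝔸_K)`, every
prime `ℓ`, `ι : ℚ̄_ℓ ≃ ℂ`, every continuous semisimple `r : Γ_K → GL_n(ℚ̄_ℓ)` with
Harris–Lan–Taylor–Thorne's property (`r ≅ r_{ℓ,ι}(π)`), every finite `v ∤ ℓ`, every irreducible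
smooth local component `πv` of `π` at `v`, every Weil–Deligne representation `W` attached to
`r|_{Γ_{K_v}}` by the Grothendieck–Deligne recipe with transport `Wℂ = ι(W)`, and every
Frobenius-semisimple representative `S` of `rec_{K_v}(πv ⊗ |det|_v^{(1-n)/2})`:
(a) `tr Wℂ.ρ(w) = tr S.ρ(w)` for all `w ∈ W_{K_v}` ("`WD(r_{p,ı}(π)|_{G_{F_v}})^{ss} =
ı⁻¹rec_{F_v}(π_v ⊗ |det|_v^{(1-n)/2})^{ss}`", Thm. 1), and (b) `Wℂ ≺_I S`
("`WD(r_{p,ı}(π)|_{G_{F_v}})^{Frob-ss} ≺ ı⁻¹rec_{F_v}(π_v|det|_v^{(1-n)/2})`", Thm. 2, with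
Lemma 8.4 (2): given (a), `≺ = ≺_I`; `≺_I` ignores Frobenius-semisimplification). Not proved here.
[cite: VarmaFMS2024, Thm. 1, Thm. 2, Def. 8.2–8.3 and Lemma 8.4 (2)]
[cite: HarrisLanTaylorThorneRMS2016, Thm. A (uniqueness clause)] -/
def theorem12_trace_eq_and_precI : Prop :=
  ∀ {K : Type} [Field K] [NumberField K], IsTotallyReal K ∨ IsCMField K →
    ∃ 𝓛 : ∀ v : HeightOneSpectrum (𝓞 K), LocalLanglandsDatum (v.adicCompletion K),
    ∀ {n : ℕ} (hcpt : isCompact_glFiniteIntegralLevel n K) (π : CuspidalAutomorphicRepData n K hcpt),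
      π.1.IsRegularAlgebraic → ∀ (ℓ : ℕ) [Fact ℓ.Prime] (ι : PadicAlgCl ℓ ≃+* ℂ)
      (r : FramedGaloisRep K (PadicAlgCl ℓ) n),
      r.toGaloisRep.IsSemisimple → HarrisLanTaylorThorne2016.IsCompatible π.1 ι r →
      ∀ (v : HeightOneSpectrum (𝓞 K)), ((ℓ : ℕ) : 𝓞 K) ∉ v.asIdeal →
      ∀ (πv : SmoothIrrep (GL (Fin n) (v.adicCompletion K))), π.1.HasLocalComponentAt v πv.ρ →
      ∀ (W : WeilDeligneRep (v.adicCompletion K) (PadicAlgCl ℓ) (Fin n → PadicAlgCl ℓ))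
        (Wℂ : WeilDeligneRep (v.adicCompletion K) ℂ (Fin n → ℂ)),
        IsWeilDeligneOfLadic (r.toLocal v).toWeilGroupHom W →
        W.IsTransportAlong (ι : PadicAlgCl ℓ →+* ℂ) Wℂ →
      ∀ (S : WeilDeligneRep (v.adicCompletion K) ℂ (Fin n → ℂ)) (hS : S.IsFrobSemisimple),
        Quotient.mk (frobSemisimpleWDSetoid (v.adicCompletion K) n) ⟨S, hS⟩ =
          (𝓛 v).recTwist ((1 - (n : ℂ)) / 2) πv →
      (∀ w : WeilGroup (v.adicCompletion K),
          LinearMap.trace ℂ (Fin n → ℂ) (Wℂ.ρ w) = LinearMap.trace ℂ (Fin n → ℂ) (S.ρ w)) ∧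
        Wℂ.PrecI S

end Varma2024

end Literature.NumberTheory.Automorphic

end
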